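import Mathlib
import Summits.ValiantsHypothesis.ValiantsHypothesis.Theorems.RigidityForcesSymmetryRankRigidMinimalReprLaplaceFiveSeparatedCaptureEqualSpans
import Summits.ValiantsHypothesis.ValiantsHypothesis.Theorems.RigidityForcesSymmetryRankRigidMinimalReprLaplaceFiveSeparatedCapture
import Summits.ValiantsHypothesis.ValiantsHypothesis.Theorems.RigidityForcesSymmetryRankRigidMinimalReprLaplaceFiveSeparatedCaptureSym

/-!
# ValiantsHypothesis / RigidityForcesSymmetry — crux `LaplaceOptimalFive` (stmt-ValiantsHypothesis-24813), young-shadow K1: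
# **K1 ON `K₃ ⊔ K₂` FOR EQUAL TRIANGLE SPANS (ANY DIMENSION) — UNCONDITIONAL**

The `K₃ ⊔ K₂ = {01, 02, 12, 34}` family of the young-shadow programme: a side-symmetric split decomposition of `P₅` on that support whose
three TRIANGLE short spans COINCIDE (`shortSpan 0 1 = shortSpan 0 2 = shortSpan 1 2 =: U`, of ANY dimension — e.g. every triangle
cut filed with the same family of symmetric letter matrices, the Laplace-atom patterns `⟨x₀x₁⟩³`, `⟨x₀x₁, x₂x₃⟩³` included; leaf factors and
all long factors arbitrary; any multiplicities; off-shell allowed) has Laplace weight `≥ 5! = 120`.  This extends ✓ `sideSym_K32canon_equalLines`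
(val-lit-p4 g17: the three spans inside one LINE) from `dim U = 1` to every `dim U`.

Mechanism (proof skeleton of ✓ `sideSym_K32canon_equalLines` verbatim; only the capture bound changes): the captured space of leaf
matrices has dimension `≥ 10 − n₃₄` (✓ `stub_obligation_captured`, idea #8) and `≤ 3·dim U` (★★ ✓ `finrank_le_three_mul_of_equalSpans`,
this seat, memo §8 CLAIM E), while each triangle cut carries `n_ab ≥ dim U` terms (its short factors span `U`); hence
`|T| ≥ 3·dim U + (10 − 3·dim U) = 10` and the weight is `12·|T| ≥ 120`.

* `L3_mono`, ★ `finrank_le_three_mul_finrank_sup` — for ARBITRARY symmetric spans `U₀₁, U₀₂, U₁₂` (CaptureIneqSym's own hypotheses):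
  `finrank W ≤ 3·finrank (U₀₁ ⊔ U₀₂ ⊔ U₁₂)` (replace the spans by their sum; equals the conjectured bound exactly when the spans coincide).
* `finrank_shortSpan_le_card` — `finrank (shortSpan T S u a b) ≤ #{t ∈ T : S t = {a,b}}`.
* ★ `sideSym_K32canon_equalSpans` — the K1 theorem (canonical placement `{01,02,12,34}`).

Honest framing.  A SUB-CASE of K1 on `K₃ ⊔ K₂` (equal triangle spans); K1 on `K₃ ⊔ K₂` in general, `CaptureIneqSym`, S2′,
`LaplaceOptimalFive` (OPEN · CONTESTED 72/120), `RankRigidMinimalRepr`, `VP ≠ VNP` are NOT proved.  No definitions, no `sorry`.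
-/

set_option linter.dupNamespace false
set_option autoImplicit false

namespace Summit.ValiantsHypothesis.ValiantsHypothesis.Theorems.RigidityForcesSymmetryRankRigidMinimalRepr

namespace LaplaceFiveSeparatedCapture

open Finset LaplaceFiveSectorSplit

/-! ### Corollary: an unconditional bound for ARBITRARY symmetric spans -/

/-- `L₃` is monotone in the three spans. [folklore] -/
theorem L3_mono {U01 U02 U12 V01 V02 V12 : Submodule ℂ (Fin 5 → Fin 5 → ℂ)}
    (h01 : U01 ≤ V01) (h02 : U02 ≤ V02) (h12 : U12 ≤ V12) : L3 U01 U02 U12 ≤ L3 V01 V02 V12 := by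
  apply Submodule.span_mono
  rintro T ((⟨u, hu, y, rfl⟩ | ⟨u, hu, y, rfl⟩) | ⟨u, hu, y, rfl⟩)
  · exact Or.inl (Or.inl ⟨u, h01 hu, y, rfl⟩)
  · exact Or.inl (Or.inr ⟨u, h02 hu, y, rfl⟩)
  · exact Or.inr ⟨u, h12 hu, y, rfl⟩

/-- ★ **UNCONDITIONAL BOUND FOR ARBITRARY SYMMETRIC SPANS:** `finrank W ≤ 3 · finrank (U₀₁ ⊔ U₀₂ ⊔ U₁₂)` — the three spans are
replaced by their sum and ✓ `finrank_le_three_mul_of_equalSpans` applies.  (Equals `CaptureIneqSym`'s bound exactly when the three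
spans coincide; weaker otherwise.) [folklore] -/
theorem finrank_le_three_mul_finrank_sup (U01 U02 U12 W : Submodule ℂ (Fin 5 → Fin 5 → ℂ))
    (hs01 : ∀ u ∈ U01, ∀ p q : Fin 5, u p q = u q p) (hs02 : ∀ u ∈ U02, ∀ p q : Fin 5, u p q = u q p)
    (hs12 : ∀ u ∈ U12, ∀ p q : Fin 5, u p q = u q p)
    (hWs : ∀ μ ∈ W, ∀ s t : Fin 5, μ s t = μ t s) (hWd : ∀ μ ∈ W, ∀ s : Fin 5, μ s s = 0)
    (hWc : ∀ μ ∈ W, contractZ μ ∈ L3 U01 U02 U12) :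
    Module.finrank ℂ W ≤ 3 * Module.finrank ℂ (U01 ⊔ U02 ⊔ U12 : Submodule ℂ (Fin 5 → Fin 5 → ℂ)) := by
  refine finrank_le_three_mul_of_equalSpans (U01 ⊔ U02 ⊔ U12) W ?_ hWs hWd fun μ hμ =>
    L3_mono (le_sup_left.trans le_sup_left) (le_sup_right.trans le_sup_left) le_sup_right (hWc μ hμ)
  intro x hx p q
  obtain ⟨y, hy, c, hc, rfl⟩ := Submodule.mem_sup.mp hx
  obtain ⟨a, ha, b, hb, rfl⟩ := Submodule.mem_sup.mp hy
  simp only [Pi.add_apply, hs01 a ha p q, hs02 b hb p q, hs12 c hc p q]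


/-- The short span on a cut has dimension at most the number of terms filed on that cut. [folklore] -/
theorem finrank_shortSpan_le_card {N : ℕ} (T : Finset (Fin N)) (S : Fin N → Finset (Fin 5))
    (u : Fin N → (Fin 5 → Fin 5) → ℂ) (a b : Fin 5) :
    Module.finrank ℂ (shortSpan T S u a b) ≤ (T.filter (fun t => S t = ({a, b} : Finset (Fin 5)))).card := by
  classical
  have hset : ((fun t => short2 (u t) a b) '' {t : Fin N | t ∈ T ∧ S t = ({a, b} : Finset (Fin 5))})
      = ↑((T.filter (fun t => S t = ({a, b} : Finset (Fin 5)))).image (fun t => short2 (u t) a b)) := by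
    ext x
    simp only [Set.mem_image, Set.mem_setOf_eq, Finset.coe_image, Finset.coe_filter]
  unfold shortSpan
  rw [hset]
  exact (finrank_span_finset_le_card _).trans Finset.card_image_le

/-- ★ **K1 ON `K₃ ⊔ K₂ = {01,02,12,34}` FOR EQUAL TRIANGLE SPANS — UNCONDITIONAL.**  A side-symmetric split decomposition of `P₅`
supported on the triangle `{0,1}, {0,2}, {1,2}` plus the disjoint edge `{3,4}` whose three triangle short spans coincide has Laplace
weight `≥ 5! = 120`: the captured leaf space has dimension `≥ 10 − n₃₄` and `≤ 3·dim U` (✓ `finrank_le_three_mul_of_equalSpans`), and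
each triangle cut carries `≥ dim U` terms, so `|T| ≥ 10`. [folklore] -/
theorem sideSym_K32canon_equalSpans {N : ℕ} (T : Finset (Fin N)) (S : Fin N → Finset (Fin 5))
    (u w : Fin N → (Fin 5 → Fin 5) → ℂ) (hdec : IsSplitDecomposition T S u w) (hsym : SideSymmetric T S u w)
    (hC : ∀ t ∈ T, S t = ({0, 1} : Finset (Fin 5)) ∨ S t = ({0, 2} : Finset (Fin 5)) ∨
      S t = ({1, 2} : Finset (Fin 5)) ∨ S t = ({3, 4} : Finset (Fin 5)))
    (hE02 : shortSpan T S u 0 2 = shortSpan T S u 0 1) (hE12 : shortSpan T S u 1 2 = shortSpan T S u 0 1) :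
    Nat.factorial 5 ≤ laplaceWeight T S := by
  classical
  obtain ⟨hcu, hcw, hid⟩ := hdec
  have hex : ∀ v : Fin 5 → Fin 5, (∑ t ∈ T, u t v * w t v) = perm5 v := fun v => by rw [hid v]; rfl
  have hsep : SepProfile34 T S := hC
  /- (0) the common span `U` consists of symmetric matrices -/
  set U := shortSpan T S u 0 1 with hUdef
  have hUs : ∀ x ∈ U, ∀ p q : Fin 5, x p q = x q p := by
    refine shortSpan_symm T S u 0 1 (by decide) fun t ht hSt v => ?_
    have hinv := (hsym t ht).1
    rw [hSt] at hinv
    exact swap_inv_of_slotInvariantOn (u t) 0 1 hinv v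
  /- (1) weight = 12·|T| and the four cut classes -/
  have hweight : laplaceWeight T S = 12 * T.card := by
    unfold laplaceWeight
    rw [Finset.sum_congr rfl (g := fun _ => 12) ?_]
    · simp [mul_comm]
    · intro t ht
      rcases hC t ht with h | h | h | h <;> rw [h] <;> decide
  have hcount :
      (T.filter (fun t => S t = ({0, 1} : Finset (Fin 5)))).card
        + (T.filter (fun t => S t = ({0, 2} : Finset (Fin 5)))).card
        + (T.filter (fun t => S t = ({1, 2} : Finset (Fin 5)))).card
        + (T.filter (fun t => S t = ({3, 4} : Finset (Fin 5)))).card ≤ T.card := by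
    rw [Finset.card_filter, Finset.card_filter, Finset.card_filter, Finset.card_filter,
      ← Finset.sum_add_distrib, ← Finset.sum_add_distrib, ← Finset.sum_add_distrib, Finset.card_eq_sum_ones T]
    apply Finset.sum_le_sum
    intro t ht
    rcases hC t ht with h | h | h | h <;> rw [h] <;> decide
  have hn01 : Module.finrank ℂ U ≤ (T.filter (fun t => S t = ({0, 1} : Finset (Fin 5)))).card :=
    finrank_shortSpan_le_card T S u 0 1
  have hn02 : Module.finrank ℂ U ≤ (T.filter (fun t => S t = ({0, 2} : Finset (Fin 5)))).card := by
    have h := finrank_shortSpan_le_card T S u 0 2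
    rwa [hE02] at h
  have hn12 : Module.finrank ℂ U ≤ (T.filter (fun t => S t = ({1, 2} : Finset (Fin 5)))).card := by
    have h := finrank_shortSpan_le_card T S u 1 2
    rwa [hE12] at h
  /- (2) coordinates for the symmetric zero-diagonal leaf matrices (as in ✓ `sideSym_K32canon_equalLines`) -/
  let P' := {x : Fin 5 × Fin 5 // x.1 < x.2}
  have hP : Fintype.card P' = 10 := by decide
  let LsymFun : (P' → ℂ) → (Fin 5 → Fin 5 → ℂ) := fun c s t =>
    if h : s < t then c ⟨(s, t), h⟩ else if h' : t < s then c ⟨(t, s), h'⟩ else 0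
  let Lsym : (P' → ℂ) →ₗ[ℂ] (Fin 5 → Fin 5 → ℂ) :=
    { toFun := LsymFun
      map_add' := by
        intro c c'
        funext s t
        simp only [LsymFun, Pi.add_apply]
        split_ifs <;> simp
      map_smul' := by
        intro r c
        funext s t
        simp only [LsymFun, Pi.smul_apply, smul_eq_mul, RingHom.id_apply]
        split_ifs <;> simp }
  have hLsym_apply : ∀ c s t, Lsym c s t = LsymFun c s t := fun _ _ _ => rfl
  have hinj : Function.Injective Lsym := by
    intro c c' h
    funext π
    have := congr_fun (congr_fun h π.1.1) π.1.2
    simpa [hLsym_apply, LsymFun, π.2] using this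
  have hsymL : ∀ c (s t : Fin 5), Lsym c s t = Lsym c t s := by
    intro c s t
    simp only [hLsym_apply, LsymFun]
    rcases lt_trichotomy s t with h | rfl | h
    · simp [h, not_lt.mpr h.le]
    · simp
    · simp [h, not_lt.mpr h.le]
  have hdiag : ∀ c (s : Fin 5), Lsym c s s = 0 := by
    intro c s
    simp [hLsym_apply, LsymFun]
  /- (3) the leaf evaluation map and its kernel -/
  let ev : (Fin 5 → Fin 5 → ℂ) →ₗ[ℂ] ((T.filter (fun t => S t = ({3, 4} : Finset (Fin 5)))) → ℂ) :=
    { toFun := fun M t => ∑ s : Fin 5, ∑ s' : Fin 5, M s s' * short2 (u t.1) 3 4 s s'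
      map_add' := by
        intro M M'
        funext t
        simp only [Pi.add_apply, add_mul, Finset.sum_add_distrib]
      map_smul' := by
        intro r M
        funext t
        simp only [Pi.smul_apply, smul_eq_mul, RingHom.id_apply, Finset.mul_sum, mul_assoc] }
  have hev_apply : ∀ M t, ev M t = ∑ s : Fin 5, ∑ s' : Fin 5, M s s' * short2 (u t.1) 3 4 s s' :=
    fun _ _ => rfl
  let ev' : (P' → ℂ) →ₗ[ℂ] ((T.filter (fun t => S t = ({3, 4} : Finset (Fin 5)))) → ℂ) := ev ∘ₗ Lsym
  have hrn := LinearMap.finrank_range_add_finrank_ker ev'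
  rw [Module.finrank_fintype_fun_eq_card, hP] at hrn
  have hrange : Module.finrank ℂ (LinearMap.range ev')
      ≤ (T.filter (fun t => S t = ({3, 4} : Finset (Fin 5)))).card := by
    have := Submodule.finrank_le (LinearMap.range ev')
    rwa [Module.finrank_fintype_fun_eq_card, Fintype.card_coe] at this
  /- (4) the captured space `W := Lsym (ker ev')` has `finrank ≤ 3·finrank U` -/
  have hWK : Module.finrank ℂ ((LinearMap.ker ev').map Lsym) = Module.finrank ℂ (LinearMap.ker ev') :=
    (LinearEquiv.finrank_eq (Submodule.equivMapOfInjective Lsym hinj (LinearMap.ker ev'))).symm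
  have hcapW : Module.finrank ℂ ((LinearMap.ker ev').map Lsym) ≤ 3 * Module.finrank ℂ U := by
    apply finrank_le_three_mul_of_equalSpans U _ hUs
    · intro μ hμ s t
      obtain ⟨c, -, rfl⟩ := Submodule.mem_map.1 hμ
      exact hsymL c s t
    · intro μ hμ s
      obtain ⟨c, -, rfl⟩ := Submodule.mem_map.1 hμ
      exact hdiag c s
    · intro μ hμ
      obtain ⟨c, hcK, rfl⟩ := Submodule.mem_map.1 hμ
      have hmem : contractZ (Lsym c) ∈ L3 (shortSpan T S u 0 1) (shortSpan T S u 0 2) (shortSpan T S u 1 2) := by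
        apply stub_obligation_captured N T S u w ⟨hcu, hcw⟩ hex hsep
        intro t ht h34
        have h0 := congr_fun (LinearMap.mem_ker.1 hcK) ⟨t, Finset.mem_filter.2 ⟨ht, h34⟩⟩
        rw [Pi.zero_apply] at h0
        simpa [ev', hev_apply] using h0
      rw [hE02, hE12] at hmem
      exact hmem
  /- (5) count -/
  have h5 : Nat.factorial 5 = 120 := by decide
  rw [h5, hweight]
  omega

end LaplaceFiveSeparatedCapture

end Summit.ValiantsHypothesis.ValiantsHypothesis.Theorems.RigidityForcesSymmetryRankRigidMinimalRepr
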